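import Mathlib
import Summits.Ventures.PercRepro2.SwOutCrossJunctionThm

/-!
# Row (SW) on every graph with a cross junction (blind cell PercRepro2, night-4 g24,
2026-08-28; proofs/NIGHT4-G24.md §7)

Theorem A_cross (`rigidOK_of_crossJunction`) makes a region with a cross junction a base region
of the series reduction (`reducible_of_crossJunction`); with `U = {l}ᶜ` this gives rows 2′SW-ALL
and (SW) on every graph in which some vertex `u ≠ l, h` has every neighbour adjacent to `h` or a
dropped vertex of ONE connected component along a simple cross-edge graph — boundary (iv) of
Theorem A_mix, which neither Theorem A (pure components), Theorem A_mix (one dropped vertex) nor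
Theorem A_sev (dropped vertices in separate components) covers.
-/

namespace Summit.Ventures.PercRepro2

namespace CrossArm

open Hull LocRows

variable {V : Type*} {E : Type*} [Fintype E] [DecidableEq E]

open scoped Classical

variable {ends : E → Sym2 V} {X : Type*} [Fintype X] {U : Set V} {l h o u : V} {p : X → V}
  {G : SimpleGraph X} [DecidableRel G.Adj]

/-- A region with a cross junction is a base region of the series reduction. -/
theorem CrossJunction.reducible_of_crossJunction (hj : CrossJunction ends U h u p G o) (hl : l ∉ U)
    (hG : G.Connected) : Reducible l h o ends U :=
  Reducible.base ends U fun ξ => hj.rigidOK_of_crossJunction (ξ := ξ) hl hG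

/-- **Row 2′SW-ALL on every graph with a cross junction** in `{l}ᶜ`. -/
theorem swAll_of_crossJunction (hlh : l ≠ h) (hj : CrossJunction ends ({l}ᶜ) h u p G o)
    (hG : G.Connected) : SwAll ends l h o :=
  swAll_of_reducible l h o hlh (hj.reducible_of_crossJunction (by simp) hG)

/-- **Row (SW) on every graph with a cross junction** (see `swAll_of_crossJunction`). -/
theorem sw_of_crossJunction (hlh : l ≠ h) (hj : CrossJunction ends ({l}ᶜ) h u p G o)
    (hG : G.Connected) : Sw ends l h o :=
  sw_of_swAll ends (swAll_of_crossJunction hlh hj hG)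

end CrossArm

end Summit.Ventures.PercRepro2
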